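import Summits.ABC.ABC.Theorems.PrimePowerRadical.Negative.WieferichValuations

/-!
# `PrimePowerRadical` (stmt-ABC-1648) IS Wieferich sparsity — both directions, unconditionally

Negative-side analysis of the crux `Summit.ABC.ABC.Theses.IneffectiveSubspace.PrimePowerRadical` (cdisprove seat).
WIEFERICH SPARSITY at a prime base `q`: `∀ ε > 0 ∃ C ∀ k ≥ 1, E_W(q,k) < C q^{εk}` with the odd Wieferich excess
`E_W(q,k) = ∏_{p odd, p ∣ q^k − 1} p^{W_p(q) − 1}` of `Negative/WieferichValuations.lean` (only Wieferich primes to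
base `q` contribute). From the sandwich `E_W · rad ∣ q^k − 1 ∣ k · rad · E_W · 2^{W_2}`:
* `wieferichSparse_of_PPRAt` — the crux at `q` implies sparsity (`E_W^{1+ε} < C₀ q^{1+ε} q^{εk}`);
* `PPRAt_of_wieferichSparse` — sparsity implies the crux at `q` (`rad > q^{k(1−2ε₁)}/D`, `ε₁ = ε/(4(1+ε))`);
* `primePowerRadical_iff_wieferichSparse : PrimePowerRadical ↔ ∀ q prime, (sparsity at q)`.
So the crux is EXACTLY the statement that, for each prime `q`, the Wieferich primes to base `q` dividing
`q^k − 1`, weighted by `(level − 1)·log p`, have total mass `o(k log q)`: a disproof needs exponential Wieferich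
mass inside a single `q^k − 1` (nothing of the kind is known or expected), a proof must bound Wieferich primes
base `q` from above in this weighted sense (nothing of the kind is known either; see `Negative/NonWieferich.lean`).
-/

noncomputable section

namespace Summit.ABC.ABC.Theorems.PrimePowerRadical.Negative

open Literature.NumberTheory.DiophantineGeometry UniqueFactorizationMonoid
open Summit.ABC.ABC.Theses.IneffectiveSubspace

/-- Real form of the lower sandwich: `E_W · rad(q^k − 1) < q^k`. [folklore] -/
theorem oddWieferichExcess_mul_radical_lt_real {q k : ℕ} (hq : q.Prime) (hk : 1 ≤ k) :
    (oddWieferichExcess q k : ℝ) * ((radical (q ^ k - 1) : ℕ) : ℝ) < (q : ℝ) ^ k := by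
  have h := (oddWieferichExcess_sandwich hq hk).1
  have h2 : q ^ k - 1 < q ^ k := Nat.sub_lt (pow_pos hq.pos k) one_pos
  have : ((oddWieferichExcess q k * radical (q ^ k - 1) : ℕ) : ℝ) < ((q ^ k : ℕ) : ℝ) := by
    exact_mod_cast lt_of_le_of_lt h h2
  push_cast at this
  exact this

/-- Real form of the upper sandwich: `q^k ≤ 2 k · rad(q^k − 1) · E_W · 2^{W_2}`. [folklore] -/
theorem pow_le_mul_oddWieferichExcess_real {q k : ℕ} (hq : q.Prime) (hk : 1 ≤ k) :
    (q : ℝ) ^ k ≤ 2 * k * ((radical (q ^ k - 1) : ℕ) : ℝ) * (oddWieferichExcess q k : ℝ)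
      * 2 ^ wieferichLevel q 2 := by
  have h := (oddWieferichExcess_sandwich hq hk).2
  have h2 : q ^ k ≤ 2 * (q ^ k - 1) := by have := two_le_pow hq.two_le hk; omega
  have h3 : q ^ k ≤ 2 * (k * radical (q ^ k - 1) * oddWieferichExcess q k * 2 ^ wieferichLevel q 2) :=
    le_trans h2 (Nat.mul_le_mul_left 2 h)
  have h' : ((q ^ k : ℕ) : ℝ) ≤
      ((2 * (k * radical (q ^ k - 1) * oddWieferichExcess q k * 2 ^ wieferichLevel q 2) : ℕ) : ℝ) := by
    exact_mod_cast h3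
  push_cast at h'
  linarith

/-- **crux(q) ⟹ Wieferich sparsity at `q`.** From `q^k < C₀ (q·rad)^{1+ε}` and `E_W · rad < q^k`:
`E_W^{1+ε} < C₀ q^{1+ε} q^{εk}`, so `E_W < C₀^{1/(1+ε)} q · q^{εk}`. [folklore] -/
theorem wieferichSparse_of_PPRAt {q : ℕ} (hq : q.Prime) (h : ∀ ε : ℝ, 0 < ε → (∃ C : ℝ, 0 < C ∧ ∀ k : ℕ, 1 ≤ k →
      ((q ^ k : ℕ) : ℝ) < C * ((rad 1 (q ^ k - 1) (q ^ k) : ℕ) : ℝ) ^ (1 + ε))) :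
    (∀ ε : ℝ, 0 < ε → ∃ C : ℝ, 0 < C ∧ ∀ k : ℕ, 1 ≤ k →
      (oddWieferichExcess q k : ℝ) < C * (q : ℝ) ^ (ε * k)) := by
  intro ε hε
  obtain ⟨C₀, hC₀, hC⟩ := h ε hε
  set t : ℝ := 1 + ε with ht
  have ht0 : 0 < t := by linarith
  have hq0 : (0 : ℝ) < q := by exact_mod_cast hq.pos
  have hq1 : (1 : ℝ) ≤ q := by exact_mod_cast hq.one_lt.le
  refine ⟨C₀ ^ (1 / t) * q, by positivity, fun k hk => ?_⟩
  set E : ℝ := (oddWieferichExcess q k : ℝ) with hEdef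
  set R : ℝ := ((radical (q ^ k - 1) : ℕ) : ℝ) with hRdef
  have hE0 : 0 < E := by rw [hEdef]; exact_mod_cast oddWieferichExcess_pos q k
  have hR0 : 0 < R := by rw [hRdef]; exact_mod_cast Nat.radical_pos _
  -- the crux instance, casts normalised: q^k < C₀ (R q)^t
  have h1 : (q : ℝ) ^ k < C₀ * (R * q) ^ t := by
    have := hC k hk
    rw [rad_family_eq hq hk] at this
    push_cast at this
    exact this
  -- lower sandwich
  have h2 : E * R < (q : ℝ) ^ k := oddWieferichExcess_mul_radical_lt_real hq hk
  have h3 : R * q ≤ (q : ℝ) ^ (k + 1) / E := by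
    rw [le_div_iff₀ hE0, pow_succ]
    nlinarith
  have h4 : (R * q) ^ t ≤ ((q : ℝ) ^ (k + 1) / E) ^ t :=
    Real.rpow_le_rpow (by positivity) h3 ht0.le
  have h5 : ((q : ℝ) ^ (k + 1) / E) ^ t = (q : ℝ) ^ (((k : ℝ) + 1) * t) / E ^ t := by
    rw [Real.div_rpow (by positivity) hE0.le, ← Real.rpow_natCast, ← Real.rpow_mul hq0.le]
    push_cast
    ring_nf
  have hqk : (0 : ℝ) < (q : ℝ) ^ k := by positivity
  have hEt : 0 < E ^ t := Real.rpow_pos_of_pos hE0 t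
  have hX : (q : ℝ) ^ (((k : ℝ) + 1) * t) = (q : ℝ) ^ k * ((q : ℝ) ^ t * (q : ℝ) ^ (ε * k)) := by
    rw [← Real.rpow_natCast, ← Real.rpow_add hq0, ← Real.rpow_add hq0]
    congr 1
    rw [ht]; ring
  have h6 : E ^ t < C₀ * ((q : ℝ) ^ t * (q : ℝ) ^ (ε * k)) := by
    have h7 : (q : ℝ) ^ k < C₀ * ((q : ℝ) ^ (((k : ℝ) + 1) * t) / E ^ t) := by
      calc (q : ℝ) ^ k < C₀ * (R * q) ^ t := h1
        _ ≤ C₀ * (((q : ℝ) ^ (k + 1)) / E) ^ t := by gcongr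
        _ = C₀ * ((q : ℝ) ^ (((k : ℝ) + 1) * t) / E ^ t) := by rw [h5]
    rw [hX, mul_div_assoc', lt_div_iff₀ hEt] at h7
    -- h7 : q^k * E^t < C₀ * (q^k * (q^t * q^(εk)))
    have h8 : (q : ℝ) ^ k * E ^ t < (q : ℝ) ^ k * (C₀ * ((q : ℝ) ^ t * (q : ℝ) ^ (ε * k))) := by
      linarith [h7]
    exact lt_of_mul_lt_mul_left h8 hqk.le
  have h9 : C₀ * ((q : ℝ) ^ t * (q : ℝ) ^ (ε * k))
      = (C₀ ^ (1 / t) * q * (q : ℝ) ^ (ε * k / t)) ^ t := by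
    rw [Real.mul_rpow (by positivity) (by positivity), Real.mul_rpow (by positivity) (by positivity),
      ← Real.rpow_mul hC₀.le, ← Real.rpow_mul hq0.le,
      show 1 / t * t = 1 by field_simp, show ε * k / t * t = ε * k by field_simp, Real.rpow_one]
    ring
  have h10 : E < C₀ ^ (1 / t) * q * (q : ℝ) ^ (ε * k / t) := by
    rw [h9] at h6
    exact (Real.rpow_lt_rpow_iff hE0.le (by positivity) ht0).mp h6
  have h11 : (q : ℝ) ^ (ε * k / t) ≤ (q : ℝ) ^ (ε * k) := by
    apply Real.rpow_le_rpow_of_exponent_le hq1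
    rw [div_le_iff₀ ht0]
    have : 0 ≤ ε * k := by positivity
    nlinarith
  calc E < C₀ ^ (1 / t) * q * (q : ℝ) ^ (ε * k / t) := h10
    _ ≤ C₀ ^ (1 / t) * q * (q : ℝ) ^ (ε * k) := by gcongr

/-- `k · (ε₁ log q) < q^{ε₁ k}` (from `x + 1 ≤ exp x`). [folklore] -/
theorem nat_mul_lt_rpow {q : ℕ} (hq : 2 ≤ q) (ε₁ : ℝ) (k : ℕ) :
    (k : ℝ) * (ε₁ * Real.log q) < (q : ℝ) ^ (ε₁ * k) := by
  have hq0 : (0 : ℝ) < q := by exact_mod_cast (by omega : 0 < q)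
  rw [Real.rpow_def_of_pos hq0]
  have := Real.add_one_le_exp (Real.log q * (ε₁ * k))
  nlinarith

/-- **Wieferich sparsity at `q` ⟹ crux(q).** From `q^k ≤ 2k·rad·E_W·2^{W_2}`, `E_W < C₁ q^{ε₁k}` and
`k < q^{ε₁k}/(ε₁ log q)`: `rad > q^{k(1−2ε₁)}/D`, and with `ε₁ = ε/(4(1+ε))` one has
`(q·rad)^{1+ε} ≥ q^{k(1+ε/2)}/D^{1+ε} ≥ q^k/D^{1+ε}`. [folklore] -/
theorem PPRAt_of_wieferichSparse {q : ℕ} (hq : q.Prime) (h : (∀ ε : ℝ, 0 < ε → ∃ C : ℝ, 0 < C ∧ ∀ k : ℕ, 1 ≤ k →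
      (oddWieferichExcess q k : ℝ) < C * (q : ℝ) ^ (ε * k))) (ε : ℝ)
    (hε : 0 < ε) :
    (∃ C : ℝ, 0 < C ∧ ∀ k : ℕ, 1 ≤ k →
      ((q ^ k : ℕ) : ℝ) < C * ((rad 1 (q ^ k - 1) (q ^ k) : ℕ) : ℝ) ^ (1 + ε)) := by
  set t : ℝ := 1 + ε with ht
  have ht1 : 1 ≤ t := by linarith
  have ht0 : 0 < t := by linarith
  set ε₁ : ℝ := ε / (4 * (1 + ε)) with hε₁
  have hε₁0 : 0 < ε₁ := by positivity
  have hkey : (1 - 2 * ε₁) * t = 1 + ε / 2 := by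
    rw [hε₁, ht]; field_simp; ring
  obtain ⟨C₁, hC₁, hE⟩ := h ε₁ hε₁0
  have hq2 := hq.two_le
  have hq0 : (0 : ℝ) < q := by exact_mod_cast hq.pos
  have hq1 : (1 : ℝ) ≤ q := by exact_mod_cast hq.one_lt.le
  have hlogq : 0 < Real.log q := Real.log_pos (by exact_mod_cast hq.one_lt)
  set W := wieferichLevel q 2 with hW
  set D : ℝ := 2 ^ (W + 1) * C₁ / (ε₁ * Real.log q) with hD
  have hD0 : 0 < D := div_pos (by positivity) (mul_pos hε₁0 hlogq)
  refine ⟨D ^ t + 1, by positivity, fun k hk => ?_⟩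
  rw [rad_family_eq hq hk]
  push_cast
  set E : ℝ := (oddWieferichExcess q k : ℝ) with hEdef
  set R : ℝ := ((radical (q ^ k - 1) : ℕ) : ℝ) with hRdef
  have hE0 : 0 < E := by rw [hEdef]; exact_mod_cast oddWieferichExcess_pos q k
  have hR0 : 0 < R := by rw [hRdef]; exact_mod_cast Nat.radical_pos _
  -- upper sandwich and the two smallness inputs
  have h1 : (q : ℝ) ^ k ≤ 2 * k * R * E * 2 ^ W := pow_le_mul_oddWieferichExcess_real hq hk
  have h2 : (k : ℝ) * (ε₁ * Real.log q) < (q : ℝ) ^ (ε₁ * k) := nat_mul_lt_rpow hq2 ε₁ k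
  have h3 : E < C₁ * (q : ℝ) ^ (ε₁ * k) := hE k hk
  -- q^k < D q^(2ε₁k) R
  have hQ0 : (0 : ℝ) < (q : ℝ) ^ (ε₁ * k) := Real.rpow_pos_of_pos hq0 _
  have h4 : (q : ℝ) ^ k < D * ((q : ℝ) ^ (ε₁ * k) * (q : ℝ) ^ (ε₁ * k)) * R := by
    have hk' : (k : ℝ) < (q : ℝ) ^ (ε₁ * k) / (ε₁ * Real.log q) := by
      rw [lt_div_iff₀ (mul_pos hε₁0 hlogq)]; exact h2
    have hk0 : (0 : ℝ) < k := by exact_mod_cast (by omega : 0 < k)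
    calc (q : ℝ) ^ k ≤ 2 * k * R * E * 2 ^ W := h1
      _ = (2 ^ (W + 1) * R) * (k * E) := by ring
      _ < (2 ^ (W + 1) * R) * ((q : ℝ) ^ (ε₁ * k) / (ε₁ * Real.log q) * (C₁ * (q : ℝ) ^ (ε₁ * k))) := by
          apply mul_lt_mul_of_pos_left _ (by positivity)
          exact mul_lt_mul'' hk' h3 hk0.le hE0.le
      _ = D * ((q : ℝ) ^ (ε₁ * k) * (q : ℝ) ^ (ε₁ * k)) * R := by
          rw [hD]; field_simp
  have h5 : (q : ℝ) ^ (ε₁ * k) * (q : ℝ) ^ (ε₁ * k) = (q : ℝ) ^ (2 * ε₁ * k) := by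
    rw [← Real.rpow_add hq0]; ring_nf
  rw [h5] at h4
  -- R > q^(k(1-2ε₁)) / D
  have hQ1 : (0 : ℝ) < (q : ℝ) ^ (2 * ε₁ * k) := Real.rpow_pos_of_pos hq0 _
  have h6 : (q : ℝ) ^ ((1 - 2 * ε₁) * k) / D < R := by
    rw [div_lt_iff₀ hD0]
    have e : (q : ℝ) ^ ((1 - 2 * ε₁) * k) = (q : ℝ) ^ k / (q : ℝ) ^ (2 * ε₁ * k) := by
      rw [eq_div_iff hQ1.ne', ← Real.rpow_natCast, ← Real.rpow_add hq0]; ring_nf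
    rw [e, div_lt_iff₀ hQ1]
    linarith [h4]
  -- (R q)^t ≥ R^t > (q^((1-2ε₁)k)/D)^t = q^((1+ε/2) k)/D^t ≥ q^k / D^t
  have hRq : R ≤ R * q := le_mul_of_one_le_right hR0.le hq1
  have h7 : ((q : ℝ) ^ ((1 - 2 * ε₁) * k) / D) ^ t < (R * q) ^ t :=
    Real.rpow_lt_rpow (by positivity) (lt_of_lt_of_le h6 hRq) ht0
  have h8 : ((q : ℝ) ^ ((1 - 2 * ε₁) * k) / D) ^ t = (q : ℝ) ^ ((1 + ε / 2) * k) / D ^ t := by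
    rw [Real.div_rpow (by positivity) hD0.le, ← Real.rpow_mul hq0.le]
    congr 2
    rw [← hkey]; ring
  have h9 : (q : ℝ) ^ k ≤ (q : ℝ) ^ ((1 + ε / 2) * k) := by
    rw [← Real.rpow_natCast]
    apply Real.rpow_le_rpow_of_exponent_le hq1
    have : (0 : ℝ) ≤ k := Nat.cast_nonneg k
    nlinarith
  have hDt : 0 < D ^ t := Real.rpow_pos_of_pos hD0 t
  have h10 : (q : ℝ) ^ k < D ^ t * (R * q) ^ t := by
    rw [h8] at h7
    rw [div_lt_iff₀ hDt] at h7
    calc (q : ℝ) ^ k ≤ (q : ℝ) ^ ((1 + ε / 2) * k) := h9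
      _ < (R * q) ^ t * D ^ t := h7
      _ = D ^ t * (R * q) ^ t := mul_comm _ _
  have hRt : 0 ≤ (R * q) ^ t := Real.rpow_nonneg (by positivity) t
  calc (q : ℝ) ^ k < D ^ t * (R * q) ^ t := h10
    _ ≤ (D ^ t + 1) * (R * q) ^ t := by nlinarith

/-- **THE REFORMULATION.** For a prime `q`, the crux at `q` (for every `ε`) is EQUIVALENT to Wieferich
sparsity at `q`. [folklore] -/
theorem PPRAt_iff_wieferichSparse {q : ℕ} (hq : q.Prime) :
    (∀ ε : ℝ, 0 < ε → (∃ C : ℝ, 0 < C ∧ ∀ k : ℕ, 1 ≤ k →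
      ((q ^ k : ℕ) : ℝ) < C * ((rad 1 (q ^ k - 1) (q ^ k) : ℕ) : ℝ) ^ (1 + ε))) ↔
    (∀ ε : ℝ, 0 < ε → ∃ C : ℝ, 0 < C ∧ ∀ k : ℕ, 1 ≤ k →
      (oddWieferichExcess q k : ℝ) < C * (q : ℝ) ^ (ε * k)) :=
  ⟨wieferichSparse_of_PPRAt hq, fun h ε hε => PPRAt_of_wieferichSparse hq h ε hε⟩

/-- **`PrimePowerRadical` ⟺ Wieferich sparsity at every prime base.** The crux is exactly the statement
that, for each prime `q`, the Wieferich primes to base `q` dividing `q^k − 1`, weighted by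
`(level − 1)·log p`, have total mass `o(k)`. [folklore] -/
theorem primePowerRadical_iff_wieferichSparse :
    PrimePowerRadical ↔ ∀ q : ℕ, q.Prime → (∀ ε : ℝ, 0 < ε → ∃ C : ℝ, 0 < C ∧ ∀ k : ℕ, 1 ≤ k →
      (oddWieferichExcess q k : ℝ) < C * (q : ℝ) ^ (ε * k)) :=
  ⟨fun h q hq => (PPRAt_iff_wieferichSparse hq).mp (h q hq),
    fun h q hq => (PPRAt_iff_wieferichSparse hq).mpr (h q hq)⟩

end Summit.ABC.ABC.Theorems.PrimePowerRadical.Negative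

end
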